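import Summits.BirchSwinnertonDyer.Rank1Residual.GaloisImage.KolyvaginInjectivityDevissage
import Summits.BirchSwinnertonDyer.Rank1Residual.GaloisImage.CanonicalComparisonLevelChange
import Summits.BirchSwinnertonDyer.Rank1Residual.GaloisImage.TorsionLevelTwoDevissageLocal
import HarnessLib

/-!
# Injectivity dévissage `m = 1 ⟹ m = 2` for the Kolyvagin systems of `E[9]` on `𝓕_can` — assembly
# (cell `b2b-bsdres`, team n1011, seat p15 GEN 4, OWNERS row T-INJ-DEV, file F-B2b;
# skeleton `cells/n1011/skel/T-INJ-DEV.md`)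

HONEST FRAMING (cell `b2b-bsdres`, run/shared/lean/b2b/bsd-rank1-residual/, verbatim in every
file): the goal of the cell is to DELETE the COMBINATION-SHAPED residual classes of the
Birch–Swinnerton-Dyer formula for ALL analytic-rank `≤ 1` elliptic curves over `ℚ` — "full BSD
formula for every rank `≤ 1` curve in class `C`" assembled STRICTLY from published theorems — so
that the rank-`≤ 1` remainder becomes exactly the CONSTRUCTION-SHAPED classes, which are TYPED
(missing-input `Prop`s), NOT attempted. This is not "finishing BSD". Team n1011 (N10 / N11, the
additive block X4 ∧ `p = 3`): research route on the CONSTRUCTION-SHAPED class X4; TOOL theorems; no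
class theorem; nothing is booked; no label and no RESIDUAL-MAP mark is moved. Theorems only: no
definition, no named fact, no `sorry`.

## What

**`KSDevissage.apply_eq_zero_of_apply_eq_zero_levelTwo`** — the instance `0 → E[3] → E[9] → E[3] → 0`
of the generic dévissage `KSDevissage.apply_eq_zero_of_apply_eq_zero_of_devissage_self` (file F-A)
with Mazur–Rubin's canonical structures `𝓕_can` on `E[9]` (`propagatedSelmerStructure W 3 1`) and
`𝓕̄_can` on `E[3]` (`propagatedSelmerStructureOne W 3`), DATUM-GENERIC (route planner 1 GEN 23): for
ANY Kolyvagin datum `D₉` on `E[9]` with primes in Sakamoto's level-`9` class (so also the deep classes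
through `E[27]`, …) outside `S`, cyclotomic transverse conditions, THE canonical comparison maps and
admissible, and the datum `D₃` on `E[3]` with the same primes, cyclotomic transverse conditions and
the canonical maps for the same primitive roots: if evaluation at `n₀` is injective on
`KS(E[3], 𝓕̄_can, D₃)` (`hinj₁`: n1011-p11's G5 `CoreRankOne.apply_eq_zero_of_apply_core_eq_zero` or
R1-58 `apply_eq_zero_of_apply_empty_eq_zero` at `n₀ = ∅`), then every Kolyvagin system of
`(E[9], 𝓕_can, D₉)` vanishing at `n₀` vanishes.  Inputs, each BY NAME: `H¹` exactness and
injectivity (F-B2a, tree `IsSES`), Selmer push/pull (n1011-p13's `induced_propagatedSelmerStructure`,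
`isCartesianAt_propagatedSelmerStructure` — no hypothesis on `E(ℚ₃)[3]`), transverse push/pull and
local injectivity from the local shapes (F-B2a with n1011-p18 / p11 / p15 shape lemmas), comparison
transport/reflect for canonical data (F-B1b).

References: B. Mazur, K. Rubin, Mem. AMS 799 (2004) §4.5; R. Sakamoto, JTNB 36 (2024) Def. 3.5,
Thm. 4.4 [Sakamoto2024]; K. Rubin, PCMI 18 (2011) Prop. 1.4.13, Prop. 1.9.5, Def. 1.9.6 [Rubin2011].
-/

noncomputable section

open scoped Classical NumberField ContRepresentation
open Field NumberField IsDedekindDomain Module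
open WeierstrassCurve Literature.NumberTheory.EllipticCurves Literature.NumberTheory.GaloisRepresentations
  Literature.NumberTheory.GaloisRepresentations.DiscreteGaloisModule Literature.NumberTheory.GaloisCohomology

namespace Summit.BirchSwinnertonDyer.Rank1Residual.GaloisImage.KSDevissage

variable (W : WeierstrassCurve ℚ) [W.IsElliptic]

/-- **Injectivity dévissage `m = 1 ⟹ m = 2` for `(E[9], 𝓕_can)` — DATUM-GENERIC** (ROUTE-1, r1
GEN 23 first say (2)).  Let `W/ℚ` be elliptic with `E(ℚ)[3] = 0`, `S` a finite set of places outside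
which `𝓕_can` on `E[9]` and `𝓕̄_can` on `E[3]` are unramified, `τ ∈ Gal(ℚ̄/ℚ(μ_9))` with
`E[9]/(τ − 1) ≅ ℤ/9` and `E[3]/(τ − 1) ≅ ℤ/3`.  Let `D₉` be ANY Kolyvagin datum on `E[9]` with primes
in Sakamoto's level-`9` class (e.g. the deep class through `E[27]`) and outside `S`, cyclotomic
transverse conditions, THE canonical comparison maps for primitive roots `η`, and admissible; let
`D′` be the datum on `E[3]` with the SAME primes, cyclotomic transverse conditions and the canonical
comparison maps for the same `η`.  If evaluation at `n₀` is injective on `KS(E[3], 𝓕̄_can, D′)`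
(`hinj₁`: n1011-p11's `CoreRankOne.apply_eq_zero_of_apply_core_eq_zero` G5, or base rigidity R1-58
at `n₀ = ∅`), then every Kolyvagin system `κ` of `(E[9], 𝓕_can, D₉)` with `κ_{n₀} = 0` vanishes.
[cite: Sakamoto2024, Def. 3.5 (p. 923) and Thm. 4.4 (1) (p. 926)] [cite: Rubin2011, Def. 2.2.1 (p. 18)] -/
theorem apply_eq_zero_of_apply_eq_zero_levelTwo [Finite (geomTorsion W ((3 : ℕ) : ℤ))]
    (h0 : ∀ P : geomTorsion W ((3 : ℕ) : ℤ),
      (∀ σ : absoluteGaloisGroup ℚ, W.torsionGaloisModule ((3 : ℕ) : ℤ) σ P = P) → P = 0)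
    {S : Finset (Place ℚ)}
    (h𝓕₉ : (propagatedSelmerStructure W 3 1).IsUnramifiedOutside S)
    (h𝓕₃ : (propagatedSelmerStructureOne W 3).IsUnramifiedOutside S)
    {Sset : Set (HeightOneSpectrum (𝓞 ℚ))} {τ : absoluteGaloisGroup ℚ}
    (hτμ : τ ∈ rootsOfUnityFixer ℚ (3 ^ (1 + 1)))
    (hτ₉ : Nonempty (cokerSubOne (W.torsionGaloisModule (((3 : ℕ) : ℤ) ^ 1 * ((3 : ℕ) : ℤ))) τ ≃+
      ZMod (3 ^ (1 + 1))))
    (hτ₃ : Nonempty (cokerSubOne (W.torsionGaloisModule ((3 : ℕ) : ℤ)) τ ≃+ ZMod 3))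
    {D₉ : KolyvaginDatum (W.torsionGaloisModule (((3 : ℕ) : ℤ) ^ 1 * ((3 : ℕ) : ℤ)))}
    {D₃ : KolyvaginDatum (W.torsionGaloisModule ((3 : ℕ) : ℤ))} (hP : D₃.primes = D₉.primes)
    (hP₉ : D₉.primes ⊆ frobeniusClassPrimes
      (W.torsionGaloisModule (((3 : ℕ) : ℤ) ^ 1 * ((3 : ℕ) : ℤ))) Sset τ (3 ^ (1 + 1)))
    (hPS : ∀ q ∈ D₉.primes, (Sum.inr q : Place ℚ) ∉ S)
    (hT₉ : D₉.transverse = cyclotomicTransverse _) (hT₃ : D₃.transverse = cyclotomicTransverse _)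
    {η : (q : HeightOneSpectrum (𝓞 ℚ)) → (ZMod (Ideal.absNorm q.asIdeal))ˣ}
    (hD₉ : D₉.HasCanonicalComparison (3 ^ (1 + 1)) η) (hD₃ : D₃.HasCanonicalComparison 3 η)
    (hadm₉ : D₉.IsAdmissible)
    {n₀ : Finset (HeightOneSpectrum (𝓞 ℚ))}
    (hinj₁ : ∀ lam : Finset (HeightOneSpectrum (𝓞 ℚ)) →
        galoisCohomology (W.torsionGaloisModule ((3 : ℕ) : ℤ)) 1,
      D₃.IsKolyvaginSystem (propagatedSelmerStructureOne W 3) lam → lam n₀ = 0 → ∀ n, lam n = 0)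
    {κ : Finset (HeightOneSpectrum (𝓞 ℚ)) →
      galoisCohomology (W.torsionGaloisModule (((3 : ℕ) : ℤ) ^ 1 * ((3 : ℕ) : ℤ))) 1}
    (hκ : D₉.IsKolyvaginSystem (propagatedSelmerStructure W 3 1) κ) (h0κ : κ n₀ = 0)
    (n : Finset (HeightOneSpectrum (𝓞 ℚ))) : κ n = 0 := by
  classical
  haveI : Fact (1 < 3) := ⟨by norm_num⟩
  haveI : NeZero (3 ^ (1 + 1)) := ⟨by norm_num⟩
  haveI : Finite (geomTorsion W (((3 : ℕ) : ℤ) ^ 1 * ((3 : ℕ) : ℤ))) := finite_geomTorsion_pow_mul W 3 1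
  have hdvd : 3 ∣ 3 ^ (1 + 1) := dvd_pow_self 3 two_ne_zero
  have hmono : ∀ q ∈ D₉.primes, q ∈ frobeniusClassPrimes (W.torsionGaloisModule ((3 : ℕ) : ℤ)) Sset τ 3 := fun q hq =>
    S24Deep.frobeniusClassPrimes_mono (W.torsionGaloisModule ((3 : ℕ) : ℤ)) (W.torsionGaloisModule (((3 : ℕ) : ℤ) ^ 1 * ((3 : ℕ) : ℤ))) (torsionGaloisModule_three_eq_one_of_nine W) Sset τ hdvd (hP₉ hq)
  have hτμ₃ : τ ∈ rootsOfUnityFixer ℚ 3 := rootsOfUnityFixer_le_of_dvd ℚ hdvd hτμ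
  have hM₉ : ∀ m : geomTorsion W (((3 : ℕ) : ℤ) ^ 1 * ((3 : ℕ) : ℤ)), 3 ^ (1 + 1) • m = 0 :=
    pow_succ_nsmul_geomTorsion_eq_zero W 3 1
  have hM₃ : ∀ m : geomTorsion W ((3 : ℕ) : ℤ), 3 • m = 0 := three_nsmul_geomTorsion_three W
  -- per-prime instances and local shapes
  have hprime : ∀ q : HeightOneSpectrum (𝓞 ℚ), Fact (Ideal.absNorm q.asIdeal).Prime :=
    fun q => ⟨FSComp.prime_absNorm_rat q⟩
  have hne : ∀ q : HeightOneSpectrum (𝓞 ℚ),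
      NeZero ((Ideal.absNorm q.asIdeal : ℕ) : q.adicCompletion ℚ) := fun q => by
    haveI : CharZero (q.adicCompletion ℚ) :=
      charZero_of_injective_algebraMap (algebraMap ℚ (q.adicCompletion ℚ)).injective
    exact ⟨Nat.cast_ne_zero.2 (FSComp.prime_absNorm_rat q).ne_zero⟩
  have hsup₃ : ∀ q ∈ D₉.primes, unramifiedSubgroup (GaloisRep.toLocal q (W.torsionGaloisModule ((3 : ℕ) : ℤ))) 1 ⊔
      cyclotomicTransverse (W.torsionGaloisModule ((3 : ℕ) : ℤ)) (Sum.inr q) = ⊤ := fun q hq => by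
    haveI := hprime q; haveI := hne q
    exact unramifiedSubgroup_sup_cyclotomicTransverse_eq_top_of_mem_frobeniusClassPrimes (W.torsionGaloisModule ((3 : ℕ) : ℤ)) (hmono q hq)
      (absNorm_sub_one_smul_eq_zero_of_mem_frobeniusClassPrimes (W.torsionGaloisModule ((3 : ℕ) : ℤ)) (hmono q hq) hτμ₃ hM₃)
      (modPCyclotomicCharacter_surjOn_absInertia_rat_holds q)
  have hM₉' : ∀ q ∈ D₉.primes, ∀ m : geomTorsion W (((3 : ℕ) : ℤ) ^ 1 * ((3 : ℕ) : ℤ)),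
      (Ideal.absNorm q.asIdeal - 1) • m = 0 := fun q hq =>
    absNorm_sub_one_smul_eq_zero_of_mem_frobeniusClassPrimes (W.torsionGaloisModule (((3 : ℕ) : ℤ) ^ 1 * ((3 : ℕ) : ℤ))) (hP₉ hq) hτμ hM₉
  have hU₉ : ∀ q ∈ D₉.primes, Nat.card (unramifiedSubgroup (GaloisRep.toLocal q (W.torsionGaloisModule (((3 : ℕ) : ℤ) ^ 1 * ((3 : ℕ) : ℤ)))) 1) = 3 ^ (1 + 1) :=
    fun q hq => natCard_unramifiedSubgroup_toLocal_of_mem_frobeniusClassPrimes (W.torsionGaloisModule (((3 : ℕ) : ℤ) ^ 1 * ((3 : ℕ) : ℤ))) (hP₉ hq) hτ₉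
  have hTc₉ : ∀ q ∈ D₉.primes, Nat.card (D₉.transverse (Sum.inr q)) = 3 ^ (1 + 1) := fun q hq => by
    haveI := hprime q; haveI := hne q
    rw [hT₉]
    exact natCard_cyclotomicTransverse_rat_of_mem_frobeniusClassPrimes' (W.torsionGaloisModule (((3 : ℕ) : ℤ) ^ 1 * ((3 : ℕ) : ℤ))) (hP₉ hq) hτ₉ (hM₉' q hq)
  have hUT₉ : ∀ q ∈ D₉.primes, unramifiedSubgroup (GaloisRep.toLocal q (W.torsionGaloisModule (((3 : ℕ) : ℤ) ^ 1 * ((3 : ℕ) : ℤ)))) 1 ⊔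
      D₉.transverse (Sum.inr q) = ⊤ := fun q hq => by
    haveI := hprime q; haveI := hne q
    rw [hT₉]
    exact unramifiedSubgroup_sup_cyclotomicTransverse_eq_top_of_mem_frobeniusClassPrimes (W.torsionGaloisModule (((3 : ℕ) : ℤ) ^ 1 * ((3 : ℕ) : ℤ))) (hP₉ hq)
      (hM₉' q hq) (modPCyclotomicCharacter_surjOn_absInertia_rat_holds q)
  have hinf₉ : ∀ q ∈ D₉.primes, unramifiedSubgroup (GaloisRep.toLocal q (W.torsionGaloisModule (((3 : ℕ) : ℤ) ^ 1 * ((3 : ℕ) : ℤ)))) 1 ⊓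
      cyclotomicTransverse (W.torsionGaloisModule (((3 : ℕ) : ℤ) ^ 1 * ((3 : ℕ) : ℤ))) (Sum.inr q) = ⊥ := fun q hq => by
    rw [← hT₉]
    exact CoreRankOne.unramified_inf_transverse_eq_bot hadm₉ hU₉ hTc₉ hUT₉ hq
  have hinjloc : ∀ q ∈ D₉.primes, Function.Injective (localMap (W.torsionInclusion (Dvd.intro_left _ rfl : ((3 : ℕ) : ℤ) ∣ ((3 : ℕ) : ℤ) ^ 1 * ((3 : ℕ) : ℤ))) (Sum.inr q)) := fun q hq =>
    localMap_torsionInclusion_injective W q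
      (natCard_invariants_toLocal_of_mem_frobeniusClassPrimes (W.torsionGaloisModule (((3 : ℕ) : ℤ) ^ 1 * ((3 : ℕ) : ℤ))) (hP₉ hq) hτ₉)
      (natCard_invariants_toLocal_of_mem_frobeniusClassPrimes (W.torsionGaloisModule ((3 : ℕ) : ℤ)) (hmono q hq) hτ₃)
  obtain ⟨nb, b, b', hb⟩ := exists_bases_torsionMulBy_three W
  refine apply_eq_zero_of_apply_eq_zero_of_devissage_self (W.torsionInclusion (Dvd.intro_left _ rfl : ((3 : ℕ) : ℤ) ∣ ((3 : ℕ) : ℤ) ^ 1 * ((3 : ℕ) : ℤ))) (W.torsionMulBy (((3 : ℕ) : ℤ) ^ 1) ((3 : ℕ) : ℤ))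
    (exists_map_torsionInclusion_eq_of_map_torsionMulBy_eq_zero W) (map_torsionInclusion_injective W h0)
    hP (fun q hq => (h𝓕₃.2 q (hPS q hq)).le) (fun q hq => (h𝓕₉.2 q (hPS q hq)).le)
    ?_ ?_ ?_ ?_ ?_ ?_ hinj₁ hκ h0κ n
  · -- `𝓕_can` pushes forward to `𝓕̄_can`
    intro v y hy
    have h := induced_propagatedSelmerStructure W 3 1
    rw [← h]
    exact AddSubgroup.mem_map_of_mem _ hy
  · -- transverse push
    intro q hq y hy
    rw [hT₉] at hy
    rw [hT₃]
    exact localMap_mem_cyclotomicTransverse (W.torsionMulBy (((3 : ℕ) : ℤ) ^ 1) ((3 : ℕ) : ℤ)) q hy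
  · -- comparison transport (F-B1b)
    intro q hq y hy w hw
    exact singularMap_localMap_eq_fs_of_hasCanonicalComparison hdvd (W.torsionMulBy (((3 : ℕ) : ℤ) ^ 1) ((3 : ℕ) : ℤ)) b b' hb hD₉ hD₃ hq
      (hP.symm ▸ hq) (hP₉ hq).2.2.1 (hmono q hq).2.2.1 hy w hw
  · -- `𝓕_can` is cartesian (n1011-p13)
    intro v x hx
    have h := isCartesianAt_propagatedSelmerStructure W 3 1 v x hx
    rwa [induced_propagatedSelmerStructure] at h
  · -- transverse pull-back
    intro q hq x hx
    rw [hT₉] at hx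
    rw [hT₃]
    exact mem_cyclotomicTransverse_of_localMap_mem (W.torsionInclusion (Dvd.intro_left _ rfl : ((3 : ℕ) : ℤ) ∣ ((3 : ℕ) : ℤ) ^ 1 * ((3 : ℕ) : ℤ))) q (hsup₃ q hq) (hinf₉ q hq) (hinjloc q hq) hx
  · -- comparison reflection (F-B1b)
    intro q hq y hy w hw
    exact singularMap_eq_fs_of_localMap_of_hasCanonicalComparison hdvd (W.torsionMulBy (((3 : ℕ) : ℤ) ^ 1) ((3 : ℕ) : ℤ)) b b' hb (W.torsionInclusion (Dvd.intro_left _ rfl : ((3 : ℕ) : ℤ) ∣ ((3 : ℕ) : ℤ) ^ 1 * ((3 : ℕ) : ℤ)))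
      (isSES_three_nine W).injective hD₉ hD₃ hq (hP.symm ▸ hq) (hP₉ hq).2.2.1 (hmono q hq).2.2.1
      hy w hw

end Summit.BirchSwinnertonDyer.Rank1Residual.GaloisImage.KSDevissage

end
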